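import Summits.Ventures.Crystal3D.Theorems.StickyWulffConstantCoaxialWallLawEndRowOnSiteDefsA
import HarnessLib

/-!
# Definitions: the FLAT (A) census summand — two-payer clause dropped, one unit charged per activation

HONEST FRAMING. Venture `Summits/Ventures/Crystal3D` (cell `crystal3d-full`), crux `CoaxialWallLaw`
(stmt-Ventures-19481, `route-Ventures-StickyWulffConstant`), REGISTERED line `WallLedgerF` (planner cf-p1), open stub
`stub_coaxialTwoSlabAdhesion`.  DEFINITIONS ONLY (objects the lane's ON-SITE/TAIL decomposition of the typed rows
`EndRowTransA / EndRowTwinHalfTurnA` (`…EndRowDefsA`, `…EndRowOnSiteDefsA`) needs for the OUTER-SHELL REDUCTION,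
19481-p1 g13 TAIL AUDIT 2026-08-28): nothing is claimed here; F-C1 not moved.

WHY.  The summand `localSummandA v S₁ S₂ X z` of the typed (A) row at a payer `z` reads the window `X ∩ B̄(z, 3)`; the
certificate universe U-W(`v_max`) bounds the number of vacancies in that window, and the typed TAIL must then cover every
window with more vacancies — but windows with two extra IRRELEVANT vacancies in the outer shell `2 < dist z x ≤ 3` carry
the census maximum `1783/420` exactly (TAIL AUDIT part 1), so no counting argument can discharge that tail.  The balls of
the outer shell enter the summand only by (i) completing readers' dozens and clause-(A) predecessors (presence-monotone),
(ii) the far-slot emptiness of twin readings (on Barlow sites never a site), (iii) the degrees of the payers pooled at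
radius `1` (absence only raises `pooledDef`) and (iv) ACTIVATING the two-payer clause `HasTwoPayers` of an end ball —
the one non-monotone effect.  The FLAT summand below removes (iv): the two-payer clause is dropped from the multiplicity
and one unit of deficiency is charged to the pool of an end ball WITHOUT two payers (an activation by outer absences costs
at least one unit of deficiency inside `B̄(b, 1)`).  The reduction theorem (`…EndRowOuterShell`):
`localSummandA v S₁ S₂ X z ≤ localSummandFlat v S₁ S₂ X' z` whenever `X ⊆ X'` agree inside `B̄(z, 2)` and `X' ∖ X`
avoids the far slots of the twin readings of `X` near `z` — so a certificate over INNER vacancy patterns (outer sites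
occupied) evaluated with the flat summand bounds every outer filling.

* `IsEndPairFlat X v S₁ S₂ b q` — `IsEndPairA` without `HasTwoPayers X b`;
* `endMultFlat`, `pooledDefFlat X b := pooledDef X b + [¬ HasTwoPayers X b]`, `localSummandFlat v S₁ S₂ X z`;
* `isEndPairFlat_of_isEndPairA`, `endMultA_le_endMultFlat_self`, `pooledDef_le_pooledDefFlat` (same configuration).
WHAT THIS IS NOT: not a census fact, not the reduction theorem, not a change of the typed rows; F-C1 not moved.
-/

noncomputable section

namespace Summit.Ventures.Crystal3D.Theorems

open Summit.Ventures.Crystal3D Finset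
open scoped InnerProductSpace

section Defs

variable (X : Finset (EuclideanSpace ℝ (Fin 3)))

/-- (A)-END PAIR WITHOUT THE TWO-PAYER CLAUSE: `IsEndPairA` with `HasTwoPayers X b` dropped. -/
def IsEndPairFlat (v : WordVersion) (S₁ S₂ : PlateSystem) (b q : EuclideanSpace ℝ (Fin 3)) : Prop :=
  q ∈ X ∧ b ∈ X ∧ ∃ G d, (S₁.Adm G d ∨ S₂.Adm G d) ∧ q - d ∈ X ∧ IsEndMove X v G d q b

open scoped Classical in
/-- END MULTIPLICITY without the two-payer clause. -/
def endMultFlat (v : WordVersion) (S₁ S₂ : PlateSystem) (b : EuclideanSpace ℝ (Fin 3)) : ℕ :=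
  (X.filter fun q => IsEndPairFlat X v S₁ S₂ b q).card

open scoped Classical in
/-- POOLED DEFICIENCY WITH ACTIVATION CHARGE: `pooledDef X b`, plus one unit if `b` does NOT have two payers in `X`
(an activation of the two-payer clause by removing balls outside `B̄(b, 1)` costs at least one unit of deficiency
inside `B̄(b, 1)`). -/
def pooledDefFlat (b : EuclideanSpace ℝ (Fin 3)) : ℝ :=
  pooledDef X b + if HasTwoPayers X b then 0 else 1

end Defs

open scoped Classical in
/-- THE FLAT SUMMAND at the payer `z`: the summand of `LocalEndRowA` with `endMultFlat / pooledDefFlat` in place of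
`endMultA / pooledDef`. -/
def localSummandFlat (v : WordVersion) (S₁ S₂ : PlateSystem) (X : Finset (EuclideanSpace ℝ (Fin 3)))
    (z : EuclideanSpace ℝ (Fin 3)) : ℝ :=
  ∑ b ∈ X.filter (fun b => dist z b ≤ 1 ∧ 0 < endMultFlat X v S₁ S₂ b),
    (endMultFlat X v S₁ S₂ b : ℝ) / pooledDefFlat X b


/-! ### Same-configuration comparisons -/

section Self

variable {X : Finset (EuclideanSpace ℝ (Fin 3))} {v : WordVersion} {S₁ S₂ : PlateSystem}

/-- An (A)-end pair is a flat end pair of the same configuration. -/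
theorem isEndPairFlat_of_isEndPairA {b q : EuclideanSpace ℝ (Fin 3)} (h : IsEndPairA X v S₁ S₂ b q) :
    IsEndPairFlat X v S₁ S₂ b q := by
  obtain ⟨hq, hb, -, G, d, hadm, hpred, hmove⟩ := h
  exact ⟨hq, hb, G, d, hadm, hpred, hmove⟩

open scoped Classical in
/-- `endMultA ≤ endMultFlat` on the same configuration. -/
theorem endMultA_le_endMultFlat_self (b : EuclideanSpace ℝ (Fin 3)) :
    endMultA X v S₁ S₂ b ≤ endMultFlat X v S₁ S₂ b := by
  unfold endMultA endMultFlat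
  exact card_le_card fun q hq => by
    rw [mem_filter] at hq ⊢
    exact ⟨hq.1, isEndPairFlat_of_isEndPairA hq.2⟩

open scoped Classical in
/-- `pooledDef ≤ pooledDefFlat` on the same configuration (the activation charge is nonnegative). -/
theorem pooledDef_le_pooledDefFlat (b : EuclideanSpace ℝ (Fin 3)) : pooledDef X b ≤ pooledDefFlat X b := by
  unfold pooledDefFlat
  split_ifs <;> linarith

end Self

end Summit.Ventures.Crystal3D.Theorems

end
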